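import Mathlib
import Summits.Ventures.PercRepro2.LocRows
import Summits.Ventures.PercRepro2.SwRow
import Summits.Ventures.PercRepro2.SwOut
import Summits.Ventures.PercRepro2.SwAllRow
import Summits.Ventures.PercRepro2.SwOutAll
import Summits.Ventures.PercRepro2.SwOutJunctionH1Defs
import Summits.Ventures.PercRepro2.SwOutJunctionH1Claw
import Summits.Ventures.PercRepro2.SwOutEdgeJunctionKey
import Summits.Ventures.PercRepro2.SwOutEdgeJunctionSw

/-!
# Row (SW) on `c5_00008` at `(l, h, o) = (0, 2, 1)` by Theorem A⁺ (blind cell PercRepro2,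
night-4 g16, 2026-08-26; proofs/NIGHT4-G15.md §2, proofs/NIGHT4-G16.md §4)

The graph `c5_00008` (edges `01, 04, 13, 23, 24, 34`) at the marks `l = 0`, `h = 2`, `o = 1` is
the smallest residual case on which row (SW) was not a CLASS theorem before Theorem A⁺ (G15 §2:
its single junction `u = 3` is ADJACENT to `h`; it was a kernel theorem by certificate only,
`SwCheckFive`).  Here it is an instance of `sw_of_junctionH1Adj`: the junction `3` is joined to
`h = 2` by one edge, its neighbour `4` is adjacent to `h`, its neighbour `1 = o` is isolated in
`G[U ∖ {h, u}]` and not adjacent to `h`, and `4` is joined to `l`.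
-/

namespace Summit.Ventures.PercRepro2

namespace LocRows

open Hull

variable {V : Type*} {E : Type*}

open scoped Classical

variable {ends : E → Sym2 V}

/-- The component of `h` in `G[U ∖ {h, u}]` is `{h}`: no edge at `h` lies inside `U ∖ {h, u}`. -/
lemma compU_h_subset_singleton {U : Set V} {h u : V} : compU ends U h u h ⊆ {h} := by
  intro v hv
  refine mem_of_conn_of_closed (ends := ends) (S := {h}) ?_ rfl hv
  intro a ha b hab
  rw [Set.mem_singleton_iff] at ha
  obtain ⟨_, e, he, hends⟩ := openGraph_adj.1 hab
  rw [ha] at hends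
  exfalso
  have he' : e ∈ within ends (U \ {h, u}) := by simpa using he
  obtain ⟨x, hx, y, hy, hxy⟩ := he'
  rw [hends, Sym2.eq_iff] at hxy
  rcases hxy with ⟨h1, _⟩ | ⟨h2, _⟩
  · exact hx.2 (by rw [← h1]; exact Or.inl rfl)
  · exact hy.2 (by rw [← h2]; exact Or.inl rfl)

/-- The graph `c5_00008`: edges `01, 04, 13, 23, 24, 34`. -/
def c5a : Fin 6 → Sym2 (Fin 5)
  | 0 => s(0, 1) | 1 => s(0, 4) | 2 => s(1, 3) | 3 => s(2, 3) | 4 => s(2, 4) | 5 => s(3, 4)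

/-- (H1) for `c5_00008` at `h = 2`, `u = 3` in the region `{0}ᶜ`: the neighbour `4` of `u` is
adjacent to `h`; the neighbour `1` is isolated in `G[U ∖ {h, u}]` and not adjacent to `h`; the
neighbour `h` itself has the singleton component and no loop. -/
theorem c5a_H1 : H1 c5a ({0}ᶜ) 2 3 := by
  intro e p hep
  fin_cases e
  · exfalso
    simp only [c5a, Sym2.eq_iff] at hep
    omega
  · exfalso
    simp only [c5a, Sym2.eq_iff] at hep
    omega
  · -- the edge `13`: `p = 1`
    have hp : p = 1 := by
      simp only [c5a, Sym2.eq_iff] at hep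
      omega
    subst hp
    right
    intro q hq e' he'
    have hq1 : q = 1 := compU_subset_singleton (by
      intro e x hex
      fin_cases e <;> simp only [c5a, Sym2.eq_iff] at hex <;> simp <;> omega) hq
    subst hq1
    fin_cases e' <;> simp [c5a] at he'
  · -- the h–u edge `23`: `p = h`
    have hp : p = 2 := by
      simp only [c5a, Sym2.eq_iff] at hep
      omega
    subst hp
    right
    intro q hq e' he'
    have hq2 : q = 2 := compU_h_subset_singleton hq
    subst hq2
    fin_cases e' <;> simp [c5a] at he'
  · exfalso
    simp only [c5a, Sym2.eq_iff] at hep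
    omega
  · -- the edge `34`: `p = 4`, adjacent to `h`
    have hp : p = 4 := by
      simp only [c5a, Sym2.eq_iff] at hep
      omega
    subst hp
    exact Or.inl ⟨4, by decide⟩

/-- **Row (SW) on `c5_00008` at `(0, 2, 1)`**: Theorem A⁺ (the junction `3` adjacent to
`h = 2`). -/
theorem sw_c5a : Sw c5a 0 2 1 := by
  refine sw_of_junctionH1Adj (l := 0) (h := 2) (o := 1) (u := 3) (by decide) ?_ ?_ (by decide)
    ⟨3, rfl⟩ ?_ c5a_H1 ?_
  · intro e; fin_cases e <;> decide
  · intro e; fin_cases e <;> decide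
  · decide
  · intro x hx0 hx2 hx1 hx3
    fin_cases x
    · exact absurd rfl hx0
    · exact absurd rfl hx1
    · exact absurd rfl hx2
    · exact absurd rfl hx3
    · exact ⟨1, by decide⟩

end LocRows

end Summit.Ventures.PercRepro2
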